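import Literature.Computability.AlgebraicComplexity.CircuitCoeffIdeal
import Literature.Computability.AlgebraicComplexity.ArithCircuitProjections
import Literature.Computability.AlgebraicComplexity.RealTauConjectureDepthFour
import HarnessLib

/-!
# Re-instantiating the integer skeleton of a circuit at a new constant vector

Setting of `BurgisserBooleanPartsA3Steps.lean` / `CircuitCoeffIdeal.lean` (Bürgisser, *Cook's versus
Valiant's hypothesis*, TCS 235 (2000), §5 (A3), p. 85): a fan-in-two circuit `P` over `k` with `s`
gates has the constant-free integer skeleton `skeleton P` (a circuit over `ℤ` in the variables of
`P` and the slot indeterminates `Y_0, …, Y_{4s}`), and substituting the constant vector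
`slotConst P` back for `Y` recovers `P.eval` (`aeval_slotSubst_skeleton`).

This file records the converse direction of the dictionary "circuits of shape `P` ⟷ points of the
coefficient variety", used by every field-descent argument for Valiant's classes (Bürgisser 2000,
§4.1 "the constants … may be replaced by a solution of the system over the smaller field"):

* `exists_reinstantiate` — for ANY commutative ring `A` and ANY vector `y ∈ A^{4s+1}` there is a
  fan-in-two circuit over `A` with `3s` gates computing `F(X, y)`, where `F = (skeleton P).eval`
  (the skeleton with its slot variables specialised to `y`; built with the tree's `substVC`).
* `exists_circuit_of_forall_aeval_circuitCoeffPoly_eq_zero` /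
  `exists_circuit_of_forall_mem_circuitCoeffIdeal` — hence every zero `y` of the coefficient
  identities (resp. of the circuit coefficient ideal) of `P` against an integer target `g` yields a
  fan-in-two circuit over `A` of size `3s` computing the image of `g`.
* `slotConst_map` — the constant vector of a change of scalars `P.map φ` is `φ ∘ slotConst P`.
* `exists_circuit_of_slotConst_eq_comp` — **descent to the ring of constants**: if `P` over `L`
  computes the image of `g` and its constant vector is the image of a vector `y` over `A` under an
  injective `ι : A →+* L`, then `g` has a fan-in-two circuit over `A` of size `3s`.

Not here: the Nullstellensatz / number-field arguments that PRODUCE interesting points `y`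
(they live with their users), and any statement about sizes better than the factor `3`.

## References

* P. Bürgisser, *Cook's versus Valiant's hypothesis*, Theoret. Comput. Sci. 235 (2000) 71–88,
  §5 (A3) p. 85. [Burgisser2000TCS]
* P. Bürgisser, *Completeness and Reduction in Algebraic Complexity Theory*, Springer 2000, §4.1
  (dependence of Valiant's classes on the field; change of scalars). [Burgisser2000]
-/

noncomputable section

open MvPolynomial

namespace Literature.Computability.AlgebraicComplexity

namespace ArithCircuit

variable {k : Type*} {σ τ : Type*}

/-- `substVC` preserves fan-in two (same gates, same wires; bookkeeping for the circuit
projections of Bürgisser 2000, Def. 2.1 / Rem. 2.2). [cite: Burgisser2000, Def. 2.1 and Rem. 2.2] -/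
theorem IsFanInTwo.substVC {P : ArithCircuit k σ} (hP : P.IsFanInTwo) (s : σ → τ ⊕ k) :
    (P.substVC s).IsFanInTwo := by
  intro g hg
  simp only [ArithCircuit.substVC, List.mem_map] at hg
  obtain ⟨g', hg', rfl⟩ := hg
  rw [Gate.fanIn_substVC]
  exact hP g' hg'

end ArithCircuit

open ArithCircuit

section SlotConstMap

variable {k k' : Type*} [CommRing k] [CommRing k'] {σ : Type*}

/-- The constant carried by a mapped operand is the image of the constant (change of scalars,
Bürgisser 2000 §4.1). [cite: Burgisser2000, §4.1] -/
theorem operandConst_map (φ : k →+* k') (u : Operand k σ) :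
    operandConst (u.map φ) = φ (operandConst u) := by
  cases u <;> simp [Operand.map, operandConst]

/-- **The constant vector of a change of scalars.** For a ring homomorphism `φ : k → k'`, the slot
constants of `P.map φ` are the images of those of `P`: `slotConst (P.map φ) i = φ (slotConst P i)`
for every slot `i` (coefficients, constant operands, output constant, and the unused slots, which
carry `0 ↦ 0`). [cite: Burgisser2000, §4.1] -/
theorem slotConst_map (φ : k →+* k') (P : ArithCircuit k σ) (i : ℕ) :
    slotConst (P.map φ) i = φ (slotConst P i) := by
  unfold slotConst
  rw [size_map]
  by_cases hi : i = 4 * P.size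
  · rw [if_pos hi, if_pos hi]
    exact operandConst_map φ P.output
  · rw [if_neg hi, if_neg hi]
    have hg : (P.map φ).gates[i / 4]? = (P.gates[i / 4]?).map (Gate.map φ) := by
      simp [ArithCircuit.map, List.getElem?_map]
    rw [hg]
    cases P.gates[i / 4]? with
    | none => simp
    | some g =>
      cases g with
      | sum args =>
        simp only [Option.map_some, Gate.map, List.getElem?_map]
        cases args[i % 4 / 2]? with
        | none => simp
        | some a =>
          simp only [Option.map_some]
          split_ifs
          · rfl
          · exact operandConst_map φ a.2
      | prod args =>
        simp only [Option.map_some, Gate.map, List.getElem?_map]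
        cases args[i % 4 / 2]? with
        | none => simp
        | some u =>
          simp only [Option.map_some]
          split_ifs
          · simp
          · exact operandConst_map φ u

end SlotConstMap

section Reinstantiate

variable {k : Type*} {σ : Type*}

/-- The substitution data for `substVC` that keeps the variables of `P` and sends the slot
variable `Y_v` to the constant `y v`. [folklore] -/
private theorem substVCFun_sumElim {A : Type*} [CommRing A] {m : ℕ} (y : Fin m → A) :
    substVCFun (k := A) (Sum.elim (fun i : σ => Sum.inl i) fun v : Fin m => Sum.inr (y v)) =
      Sum.elim X fun v => C (y v) := by
  funext x
  cases x <;> rfl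

/-- **Re-instantiation of the skeleton.** For every commutative ring `A` and every constant vector
`y ∈ A^{4s+1}` there is a fan-in-two circuit over `A` with exactly `3s` gates computing
`F(X, y)`, the polynomial of the integer skeleton of `P` with its slot indeterminates specialised to
`y` (Bürgisser 2000 TCS §5 (A3): the skeleton `Γ_n` run "on these constants"). It is the skeleton,
read over `A`, with `Y_v ↦ y_v` substituted (`substVC`). [cite: Burgisser2000TCS, §5 (A3) p. 85] -/
theorem exists_reinstantiate (P : ArithCircuit k σ) (A : Type*) [CommRing A]
    (y : Fin (4 * P.size + 1) → A) :
    ∃ Q : ArithCircuit A σ, Q.IsFanInTwo ∧ Q.size = 3 * P.size ∧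
      Q.eval = aeval (Sum.elim X fun v => C (y v)) (skeleton P).eval := by
  refine ⟨((skeleton P).map (Int.castRingHom A)).substVC
      (Sum.elim (fun i : σ => Sum.inl i) fun v => Sum.inr (y v)), ?_, ?_, ?_⟩
  · exact ((isFanInTwo_skeleton P).map _).substVC _
  · rw [size_substVC, size_map, size_skeleton]
  · rw [eval_substVC, eval_map_apply, substVCFun_sumElim, ← algebraMap_int_eq,
      aeval_map_algebraMap]

/-- A zero `y ∈ A^{4s+1}` of all coefficient identities of `P` against the integer target `g`
yields a fan-in-two circuit over `A` with `3s` gates computing the image of `g`: the skeleton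
re-instantiated at `y`. [cite: Burgisser2000TCS, §5 (A3) p. 85] -/
theorem exists_circuit_of_forall_aeval_circuitCoeffPoly_eq_zero {A : Type*} [CommRing A]
    (P : ArithCircuit k σ) (g : MvPolynomial σ ℤ) (y : Fin (4 * P.size + 1) → A)
    (hy : ∀ α, aeval y (circuitCoeffPoly P g α) = 0) :
    ∃ Q : ArithCircuit A σ, Q.IsFanInTwo ∧ Q.size = 3 * P.size ∧
      Q.Computes (map (Int.castRingHom A) g) := by
  obtain ⟨Q, h1, h2, h3⟩ := exists_reinstantiate P A y
  exact ⟨Q, h1, h2, h3.trans ((forall_aeval_circuitCoeffPoly_eq_zero_iff P g y).1 hy)⟩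

/-- Over a commutative `ℚ`-algebra `A`: a zero `y ∈ A^{4s+1}` of the circuit coefficient ideal of
`P` against `g` yields a fan-in-two circuit over `A` with `3s` gates computing the image of `g`.
[cite: Burgisser2000TCS, §5 (A3) p. 85] -/
theorem exists_circuit_of_forall_mem_circuitCoeffIdeal {A : Type*} [CommRing A] [Algebra ℚ A]
    (P : ArithCircuit k σ) (g : MvPolynomial σ ℤ) (y : Fin (4 * P.size + 1) → A)
    (hy : ∀ f ∈ circuitCoeffIdeal P g, aeval y f = 0) :
    ∃ Q : ArithCircuit A σ, Q.IsFanInTwo ∧ Q.size = 3 * P.size ∧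
      Q.Computes (map (Int.castRingHom A) g) := by
  obtain ⟨Q, h1, h2, h3⟩ := exists_reinstantiate P A y
  exact ⟨Q, h1, h2, h3.trans ((forall_mem_circuitCoeffIdeal_iff P g y).1 hy)⟩

/-- Naturality of the skeleton substitution in the constants: mapping `F(X, y)` along
`ι : A → L` gives `F(X, ι ∘ y)` (the skeleton `F` has integer coefficients; Bürgisser 2000 TCS
§5 (A3) runs the same `Γ_n` over `ℂ` and over `𝔽_p`). [cite: Burgisser2000TCS, §5 (A3) p. 85] -/
theorem map_aeval_skeleton_eval {A L : Type*} [CommRing A] [CommRing L] (ι : A →+* L)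
    (P : ArithCircuit k σ) (y : Fin (4 * P.size + 1) → A) :
    map ι (aeval (Sum.elim X fun v => C (y v)) (skeleton P).eval) =
      aeval (Sum.elim X fun v => C (ι (y v))) (skeleton P).eval := by
  rw [MvPolynomial.aeval_def, MvPolynomial.aeval_def, MvPolynomial.eval₂_comp_left]
  congr 1
  · exact RingHom.ext_int _ _
  · funext x
    cases x <;> simp [map_X, map_C]

/-- **Descent to the ring of constants.** Let `ι : A → L` be an injective ring homomorphism and
`P` a fan-in-two circuit over `L` computing the image of the integer polynomial `g`, whose whole
constant vector is the image of a vector `y ∈ A^{4s+1}`: `slotConst P v = ι (y v)` for every slot.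
Then `g` has a fan-in-two circuit over `A` with `3s` gates (the skeleton of `P` run on `y`):
`F(X, ι y) = g` over `L`, and `F(X, ·)` commutes with `ι`, which is injective on polynomials.
This is the circuit form of "constants in a subring may be taken as the ground ring"
(Bürgisser 2000, §4.1). [cite: Burgisser2000, §4.1] -/
theorem exists_circuit_of_slotConst_eq_comp {A L : Type*} [CommRing A] [CommRing L]
    (ι : A →+* L) (hι : Function.Injective ι) (P : ArithCircuit L σ) (h2 : P.IsFanInTwo)
    (g : MvPolynomial σ ℤ) (hg : P.Computes (map (Int.castRingHom L) g))
    (y : Fin (4 * P.size + 1) → A) (hy : ∀ v : Fin (4 * P.size + 1), slotConst P v = ι (y v)) :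
    ∃ Q : ArithCircuit A σ, Q.IsFanInTwo ∧ Q.size = 3 * P.size ∧
      Q.Computes (map (Int.castRingHom A) g) := by
  refine exists_circuit_of_forall_aeval_circuitCoeffPoly_eq_zero P g y ?_
  rw [forall_aeval_circuitCoeffPoly_eq_zero_iff]
  apply MvPolynomial.map_injective ι hι
  rw [map_aeval_skeleton_eval, map_map, RingHom.eq_intCast' (ι.comp (Int.castRingHom A))]
  have hP : aeval (slotSubst P) (skeleton P).eval = map (Int.castRingHom L) g :=
    (aeval_slotSubst_skeleton P h2).trans hg
  convert hP using 3
  funext x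
  cases x with
  | inl i => rfl
  | inr v => exact (congrArg C (hy v)).symm

end Reinstantiate

end Literature.Computability.AlgebraicComplexity

end
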